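import Mathlib.RingTheory.Smooth.Basic
import Mathlib.Algebra.DualNumber
import Mathlib.RingTheory.AdjoinRoot
import Mathlib.RingTheory.Artinian.Ring
import Mathlib.RingTheory.LocalProperties.Reduced
import Mathlib.LinearAlgebra.Dual.Lemmas
import Mathlib.FieldTheory.IsAlgClosed.Basic
import Mathlib.RingTheory.Nakayama
import Mathlib.Algebra.Polynomial.Div
import HarnessLib

/-!
# Finite formally smooth algebras over a field are reduced

Topic `Literature/RingTheory/Smooth`. The zero-dimensional case of "smooth over a field implies
regular" [Matsumura1987, §28 Lemma 1: a Noetherian local ring `(A, m, K)` containing a field `k`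
which is `m`-smooth over `k` is regular]: a regular local ring of dimension `0` is a field, so

* `maximalIdeal_eq_bot_of_formallySmooth` — a local algebra `B`, finite over a field `K`, with a
  `K`-rational point `π : B →ₐ[K] K` and formally smooth over `K`, is a field (`m_B = 0`);
* `isReduced_of_formallySmooth_of_finite` — a finite formally smooth algebra over an
  algebraically closed field is reduced (apply the above to the localizations at the maximal
  ideals, whose residue fields are `K`).

The proof given here is the elementary core of Matsumura's argument (lift `A → A/m²` to a
polynomial-type ring and compare), cut down to dimension `0` so that no completion or dimension
theory is needed: if `m ≠ 0`, pick `u ∈ m ∖ m²` (Nakayama) and a `K`-linear `λ : B → K` vanishing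
on `K·1 + m²` with `λ(u) = 1`; then `b ↦ π(b) + λ(b)ε` is a `K`-algebra map `B → K[ε]` (a tangent
vector at the point `π`). Compose with `K[ε] → K[t]/(t^{N+1}) ⧸ (t²)` and lift, by formal
smoothness (Mathlib's `Algebra.FormallySmooth.lift` along the nilpotent ideal `(t²)`), to
`f : B → K[t]/(t^{N+1})`; then `f(u) = t(1 + ct)` is a unit multiple of `t`, so `u^N = 0`
(`m` is nilpotent, `B` being Artinian) forces `t^N = 0` in `K[t]/(t^{N+1})`, a contradiction.

Used for the zero-dimensional case of Grothendieck's algebraic de Rham theorem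
(`Literature.AlgebraicGeometry.Motives.AffineAlgebraicDeRham`): a finite smooth `ℂ`-algebra
`ℂ[x]/I` is reduced, so `I` is radical. Everything is proved; no named facts.

## References

* [Matsumura1987] H. Matsumura, *Commutative Ring Theory*, CUP 1986/87, §28 Lemma 1 and
  Thm 28.7 (`m`-smooth local rings over a field are regular), §25–26 for `0`-smoothness.
* The Stacks Project, Tag 00TI (formally smooth ring maps; infinitesimal lifting). [StacksProject]
-/

noncomputable section

open IsLocalRing Polynomial

namespace Literature.RingTheory.Smooth

section Local

variable {K B : Type*} [Field K] [CommRing B] [Algebra K B] [IsLocalRing B]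

/-- The kernel of a `K`-rational point `π : B → K` of a local `K`-algebra is the maximal ideal.
[folklore] -/
theorem ker_ratPoint_eq_maximalIdeal (π : B →ₐ[K] K) :
    RingHom.ker π = maximalIdeal B :=
  IsLocalRing.eq_maximalIdeal
    (RingHom.ker_isMaximal_of_surjective π fun c => ⟨algebraMap K B c, π.commutes c⟩)

/-- A rational point kills the maximal ideal. [folklore] -/
theorem ratPoint_eq_zero_of_mem (π : B →ₐ[K] K) {x : B} (hx : x ∈ maximalIdeal B) : π x = 0 := by
  rwa [← ker_ratPoint_eq_maximalIdeal π, RingHom.mem_ker] at hx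

/-- A `K`-linear functional `λ` on a local `K`-algebra with rational point `π` which kills `1` and
`m²` is a point derivation at `π`: `λ(ab) = π(a)λ(b) + π(b)λ(a)`. [folklore] -/
theorem leibniz_of_map_one_of_map_sq (π : B →ₐ[K] K) (l : B →ₗ[K] K) (h1 : l 1 = 0)
    (h2 : ∀ x ∈ maximalIdeal B, ∀ y ∈ maximalIdeal B, l (x * y) = 0) (a b : B) :
    l (a * b) = π a * l b + π b * l a := by
  have hmem : ∀ c : B, c - algebraMap K B (π c) ∈ maximalIdeal B := fun c => by
    rw [← ker_ratPoint_eq_maximalIdeal π, RingHom.mem_ker]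
    simp
  have hab : a * b = (a - algebraMap K B (π a)) * (b - algebraMap K B (π b)) +
      π a • b + π b • a - (π a * π b) • (1 : B) := by
    simp only [Algebra.smul_def, mul_one, map_mul]
    ring
  rw [hab, map_sub, map_add, map_add, h2 _ (hmem a) _ (hmem b), map_smul, map_smul, map_smul, h1,
    smul_eq_mul, smul_eq_mul, smul_zero, sub_zero, zero_add]

/-- The tangent vector attached to a point derivation: `b ↦ π(b) + λ(b) ε` is a `K`-algebra map to
the dual numbers `K[ε]`. [folklore] -/
def tangentHom (π : B →ₐ[K] K) (l : B →ₗ[K] K) (h1 : l 1 = 0)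
    (h2 : ∀ x ∈ maximalIdeal B, ∀ y ∈ maximalIdeal B, l (x * y) = 0) : B →ₐ[K] DualNumber K where
  toFun b := ((π b, l b) : TrivSqZeroExt K K)
  map_one' := TrivSqZeroExt.ext (by simp) (by simpa using h1)
  map_mul' a b := by
    refine TrivSqZeroExt.ext (by simp) ?_
    simp only [TrivSqZeroExt.snd_mul, TrivSqZeroExt.snd_mk, TrivSqZeroExt.fst_mk, smul_eq_mul,
      MulOpposite.smul_eq_mul_unop, MulOpposite.unop_op, leibniz_of_map_one_of_map_sq π l h1 h2]
    ring
  map_zero' := TrivSqZeroExt.ext (by simp) (by simp)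
  map_add' a b := TrivSqZeroExt.ext (by simp) (by simp)
  commutes' c := by
    refine TrivSqZeroExt.ext (by simp [Algebra.algebraMap_eq_smul_one]) ?_
    simp [Algebra.algebraMap_eq_smul_one, h1]

/-- The tangent map takes the value `(π b, λ b)`. [folklore] -/
@[simp]
theorem tangentHom_apply (π : B →ₐ[K] K) (l : B →ₗ[K] K) (h1 : l 1 = 0)
    (h2 : ∀ x ∈ maximalIdeal B, ∀ y ∈ maximalIdeal B, l (x * y) = 0) (b : B) :
    tangentHom π l h1 h2 b = ((π b, l b) : TrivSqZeroExt K K) :=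
  rfl

/-- In the truncated polynomial ring `K[t]/(t^M)` the class `τ` of `t` satisfies `τ^M = 0`.
[folklore] -/
theorem root_pow_eq_zero (M : ℕ) : AdjoinRoot.root ((X : K[X]) ^ M) ^ M = 0 := by
  rw [← AdjoinRoot.mk_X, ← map_pow, AdjoinRoot.mk_self]

/-- … and `τ^N ≠ 0` for `N < M`. [folklore] -/
theorem root_pow_ne_zero {M N : ℕ} (h : N < M) : AdjoinRoot.root ((X : K[X]) ^ M) ^ N ≠ 0 := by
  rw [← AdjoinRoot.mk_X, ← map_pow, Ne, AdjoinRoot.mk_eq_zero, X_pow_dvd_iff]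
  intro H
  have := H N h
  rw [coeff_X_pow_self] at this
  exact one_ne_zero this

/-- **A finite formally smooth local algebra with a rational point is a field.** Let `B` be a
local `K`-algebra, finite over the field `K`, with a `K`-rational point `π : B →ₐ[K] K`, and
formally smooth over `K`. Then `m_B = 0`. (Dimension-zero case of [Matsumura1987, §28 Lemma 1]:
`m`-smooth local rings over a field are regular; proof by lifting a tangent vector
`B → K[ε]` through the nilpotent thickenings `K[t]/(t^{N+1}) → K[ε]`.)
[cite: Matsumura1987, §28 Lemma 1] -/
theorem maximalIdeal_eq_bot_of_formallySmooth [Module.Finite K B] [Algebra.FormallySmooth K B]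
    (π : B →ₐ[K] K) : maximalIdeal B = ⊥ := by
  classical
  haveI : IsArtinianRing B := IsArtinianRing.of_finite K B
  haveI : IsNoetherianRing B := isNoetherian_of_tower K (inferInstance : IsNoetherian K B)
  by_contra hm
  -- Nakayama: `m ≠ m²`, pick `u ∈ m ∖ m²`
  obtain ⟨u, hum, hum2⟩ : ∃ u ∈ maximalIdeal B, u ∉ maximalIdeal B ^ 2 := by
    by_contra! H
    apply hm
    refine Submodule.eq_bot_of_le_smul_of_le_jacobson_bot (maximalIdeal B) (maximalIdeal B)
      (IsNoetherian.noetherian _) ?_ (maximalIdeal_le_jacobson ⊥)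
    intro x hx
    have := H x hx
    rwa [pow_two] at this
  -- `u` is nilpotent: `u ^ N = 0`
  obtain ⟨N, hN⟩ : ∃ N : ℕ, u ^ N = 0 := by
    obtain ⟨N, hN⟩ := IsArtinianRing.isNilpotent_jacobson_bot (R := B)
    refine ⟨N, ?_⟩
    have hu : u ∈ Ideal.jacobson (⊥ : Ideal B) := by
      rwa [jacobson_eq_maximalIdeal ⊥ bot_ne_top]
    have := Ideal.pow_mem_pow hu N
    rw [hN] at this
    simpa using this
  -- a tangent functional `λ` with `λ(K·1 + m²) = 0`, `λ u = 1`
  set W : Submodule K B := (maximalIdeal B ^ 2).restrictScalars K ⊔ K ∙ (1 : B) with hW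
  have huW : u ∉ W := by
    intro h
    obtain ⟨w, hw, z, hz, hwz⟩ := Submodule.mem_sup.mp h
    obtain ⟨c, rfl⟩ := Submodule.mem_span_singleton.mp hz
    have hπu : π u = 0 := ratPoint_eq_zero_of_mem π hum
    have hw' : w ∈ maximalIdeal B := Ideal.pow_le_self two_ne_zero hw
    have hπw : π w = 0 := ratPoint_eq_zero_of_mem π hw'
    have hc : c = 0 := by
      have := congrArg π hwz
      rw [map_add, hπw, map_smul, map_one, smul_eq_mul, mul_one, zero_add, hπu] at this
      exact this
    rw [hc, zero_smul, add_zero] at hwz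
    rw [← hwz] at hum2
    exact hum2 hw
  obtain ⟨l₀, hl₀u, hl₀W⟩ := Submodule.exists_dual_map_eq_bot_of_notMem huW inferInstance
  set l : B →ₗ[K] K := (l₀ u)⁻¹ • l₀ with hl
  have hlu : l u = 1 := by simp [hl, inv_mul_cancel₀ hl₀u]
  have hlW : ∀ w ∈ W, l w = 0 := fun w hw => by
    have : l₀ w ∈ W.map l₀ := Submodule.mem_map_of_mem hw
    rw [hl₀W, Submodule.mem_bot] at this
    simp [hl, this]
  have h1 : l 1 = 0 := hlW 1 (Submodule.mem_sup_right (Submodule.mem_span_singleton_self _))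
  have h2 : ∀ x ∈ maximalIdeal B, ∀ y ∈ maximalIdeal B, l (x * y) = 0 := fun x hx y hy =>
    hlW _ (Submodule.mem_sup_left (by rw [pow_two]; exact Ideal.mul_mem_mul hx hy))
  -- the tangent vector `θ : B → K[ε]`, and `θ u = ε`
  let θ : B →ₐ[K] DualNumber K := tangentHom π l h1 h2
  have hθu : θ u = DualNumber.eps := by
    have hπu : π u = 0 := ratPoint_eq_zero_of_mem π hum
    refine TrivSqZeroExt.ext ?_ ?_
    · change π u = TrivSqZeroExt.fst DualNumber.eps
      rw [DualNumber.fst_eps, hπu]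
    · change l u = TrivSqZeroExt.snd DualNumber.eps
      rw [DualNumber.snd_eps, hlu]
  -- the thickening `C = K[t]/(t^{N+1})`, `τ = t`, `J = (τ²)` nilpotent
  set C : Type _ := AdjoinRoot ((X : K[X]) ^ (N + 1)) with hC
  set τ : C := AdjoinRoot.root ((X : K[X]) ^ (N + 1)) with hτ
  have hτN1 : τ ^ (N + 1) = 0 := root_pow_eq_zero (N + 1)
  set J : Ideal C := Ideal.span {τ ^ 2} with hJ
  have hJnil : IsNilpotent J := by
    refine ⟨N + 1, ?_⟩
    rw [hJ, Ideal.span_singleton_pow, Ideal.zero_eq_bot, Ideal.span_singleton_eq_bot, ← pow_mul]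
    rw [show 2 * (N + 1) = (N + 1) + (N + 1) by ring, pow_add, hτN1, zero_mul]
  set e : C ⧸ J := Ideal.Quotient.mk J τ with he
  have he2 : e * e = 0 := by
    rw [he, ← map_mul, Ideal.Quotient.eq_zero_iff_mem, ← pow_two]
    exact Ideal.subset_span rfl
  let ψ : DualNumber K →ₐ[K] C ⧸ J :=
    DualNumber.lift ⟨(Algebra.ofId K (C ⧸ J), e), he2, fun _ => Commute.all _ _⟩
  have hψ : ψ DualNumber.eps = e := DualNumber.lift_apply_eps _
  -- lift `ψ ∘ θ : B → C/J` to `f : B → C`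
  let f : B →ₐ[K] C := Algebra.FormallySmooth.lift J hJnil (ψ.comp θ)
  have hf : Ideal.Quotient.mk J (f u) = e := by
    rw [Algebra.FormallySmooth.mk_lift, AlgHom.comp_apply, hθu, hψ]
  -- `f u = τ (1 + c τ)`
  obtain ⟨c, hc⟩ : ∃ c : C, c * τ ^ 2 = f u - τ := by
    rw [← Ideal.mem_span_singleton', ← hJ, ← Ideal.Quotient.eq, hf]
  have hfu : f u = τ * (1 + c * τ) := by
    rw [mul_add, mul_one, ← sub_eq_iff_eq_add', ← hc]
    ring
  have hunit : IsUnit (1 + c * τ) :=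
    IsNilpotent.isUnit_one_add ⟨N + 1, by rw [mul_pow, hτN1, mul_zero]⟩
  -- `u ^ N = 0` forces `τ ^ N = 0`: contradiction
  have hτN : τ ^ N = 0 := by
    have h := congrArg f hN
    rw [map_pow, map_zero, hfu, mul_pow, (hunit.pow N).mul_left_eq_zero] at h
    exact h
  exact root_pow_ne_zero (K := K) (Nat.lt_succ_self N) hτN

/-- Hence such an algebra is a field. [cite: Matsumura1987, §28 Lemma 1] -/
theorem isField_of_formallySmooth [Module.Finite K B] [Algebra.FormallySmooth K B]
    (π : B →ₐ[K] K) : IsField B :=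
  (IsLocalRing.isField_iff_maximalIdeal_eq.mpr (maximalIdeal_eq_bot_of_formallySmooth π))

/-- … and in particular reduced. [cite: Matsumura1987, §28 Lemma 1] -/
theorem isReduced_of_formallySmooth_local [Module.Finite K B] [Algebra.FormallySmooth K B]
    (π : B →ₐ[K] K) : IsReduced B :=
  letI := (isField_of_formallySmooth π).toField
  inferInstance

end Local

/-- Over an algebraically closed field, a local algebra which is finite over `K` has a
`K`-rational point (its residue field is `K`). [folklore] -/
theorem nonempty_ratPoint_of_isAlgClosed {K B : Type*} [Field K] [IsAlgClosed K] [CommRing B]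
    [Algebra K B] [IsLocalRing B] [Module.Finite K B] : Nonempty (B →ₐ[K] K) := by
  have hb : Function.Bijective (algebraMap K (B ⧸ maximalIdeal B)) :=
    IsAlgClosed.algebraMap_bijective_of_isIntegral (k := K) (K := B ⧸ maximalIdeal B)
  let e : K ≃ₐ[K] B ⧸ maximalIdeal B := AlgEquiv.ofBijective (Algebra.ofId K _) hb
  exact ⟨(e.symm : (B ⧸ maximalIdeal B) →ₐ[K] K).comp (Ideal.Quotient.mkₐ K (maximalIdeal B))⟩

/-- **Finite formally smooth algebras over an algebraically closed field are reduced**: if `A` is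
a commutative `K`-algebra, `K` algebraically closed, `A` finite-dimensional over `K` and formally
smooth over `K`, then `A` has no nilpotents (its localizations at maximal ideals are finite
formally smooth local algebras with residue field `K`, hence fields by
`maximalIdeal_eq_bot_of_formallySmooth`; reducedness is local). Equivalently `A ≅ K × ⋯ × K`.
(Consequence of [Matsumura1987, §28 Lemma 1].) [cite: Matsumura1987, §28 Lemma 1] -/
theorem isReduced_of_formallySmooth_of_finite (K : Type*) {A : Type*} [Field K] [IsAlgClosed K]
    [CommRing A] [Algebra K A] [Module.Finite K A] [Algebra.FormallySmooth K A] : IsReduced A := by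
  haveI : IsArtinianRing A := IsArtinianRing.of_finite K A
  refine isReduced_ofLocalizationMaximal A fun J hJ => ?_
  have hsurj : Function.Surjective (algebraMap A (Localization.AtPrime J)) :=
    IsArtinianRing.localization_surjective J.primeCompl _
  haveI : Module.Finite K (Localization.AtPrime J) :=
    Module.Finite.of_surjective
      (IsScalarTower.toAlgHom K A (Localization.AtPrime J)).toLinearMap hsurj
  obtain ⟨π⟩ := nonempty_ratPoint_of_isAlgClosed (K := K) (B := Localization.AtPrime J)
  exact isReduced_of_formallySmooth_local π

end Literature.RingTheory.Smooth

end
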